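import Mathlib
import HarnessLib
import Summits.NavierStokesRegularity.NavierStokesRegularity.Theorems.PoloidalWindowDoorLrcModEntireCurvedTimeSplit

/-!
# Route `PoloidalWindowDoor`, item `LrcModEntire` (stmt-NavierStokesRegularity-20428), cell (Q4-curved) of the (TH) column —
# B-TSPLITc LOCAL IN THE ARCLENGTH — `…CurvedTimeSplit` with the pin/parallel-web hypothesis only for `s` in an open set `S`

Cell ns-regularity-ideate, helper seat ns-k2-port-2 g9 under the LEAD of item 20428 (ns-poloidal-K2-p3 g17, memo `Cruxes/LrcModEntire/T2B-g17.md` §6(6b)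
«Huygens in time gives `V = α(s) + β(z)`», input of (★) in §6(6c)); `--supports stmt-NavierStokesRegularity-20428 --as helper`.  The curved analogue of port-2 g8's
`…Q4SonicHotSheetTimeSplit` (straight branch): over a CURVED base branch `Γ` with signed curvature `k(s)` the Huygens identity of the web package in the Fermi frame of
`Γ` reads (K2-p2 g16's `…CurvedWebHuygens.curved_huygens_identity`, coefficients functions of `(τ, z)` only — port-2 g6's `…RidgeWebLawHoriz` makes the ridge
curvature `κ(τ,z) = −ΔₕF` constant along every web at every time)

  `κ(τ,z)·(1 − k(s)G)²·G_z² = (R″(τ,z) − μ(τ,z)κ(τ,z))·((1 − k(s)G)² + G_s²)`,  `G = G(τ,s,z)` the time-dependent web function.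

If the webs are PARALLEL at `τ = 0` (`G(0,s,z) = d(z)`, the (Q4-curved) package `…CurvedWebPackage.curved_web_package`) with Fermi factor `1 − k(s)d(z) ≠ 0`, then
differentiating the family in `τ` at `τ = 0` (where `G_s = 0`, `G_z = d′`) the two Fermi-factor terms `2κJJ_τd′²` and `2(R″−μκ)JJ_τ` CANCEL (by the identity at
`τ = 0`, `R″ − μκ = κd′²`), leaving the SAME law as over a straight branch:

* `curved_webSpeed_zderiv_eq` — `2κ(0,z)d′(z)·D(∂_zG)(0,s,z)[(1,0,0)] = ∂_τ(R″ − μκ)(0,z) − ∂_τκ(0,z)·d′(z)²`;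
* ★ `curved_webSpeed_zderiv_indep` — for `κ(0,z) ≠ 0`, `d′(z) ≠ 0`: `D(∂_zG)(0,s,z)[(1,0,0)]` does not depend on `s`;
* ★ `curved_webSpeed_split` — on a height interval where `κ(0,·) ≠ 0`, `d′ ≠ 0`, `1 − k(s)d ≠ 0`: **`V(s,z) − V(s′,z)` does not depend on `z`**, `V := ∂_τG(0,·,·)`,
  i.e. `V(s,z) = α(s) + β(z)` (Schwarz `…Q4SonicHotSheetTimeSplit.fderiv_dz_dtau_swap`).

Currency: `G : ℝ × ℝ × ℝ → ℝ` in the variables `q = (τ, s, z)`, `C²` on an open set `O`; `k : ℝ → ℝ` the signed curvature of the base branch (any function of `s`);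
partial derivatives as `fderiv ℝ G q` applied to `(1,0,0)`, `(0,1,0)`, `(0,0,1)`.
WHAT THIS IS NOT: not a claim about Navier–Stokes regularity — calculus for the hypothetical time-dependent web of the research slots `stub_Q4curvedAperiodic` /
`stub_Q4sonicLineNegIsolated` (registry twist_split v13/v14); no stub is closed here; items 20428 / 19708 / 27893 OPEN.
-/

noncomputable section

set_option linter.dupNamespace false
set_option linter.style.longLine false

namespace Summit.NavierStokesRegularity.NavierStokesRegularity.Theorems.PoloidalWindowDoorLrcModEntireCurvedTimeSplitLocal

open Set Function Filter Topology Metric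
open scoped ContDiff
open Summit.NavierStokesRegularity.NavierStokesRegularity.Theorems.PoloidalWindowDoorLrcModEntireQ4SonicHotSheetTimeSplit
open Summit.NavierStokesRegularity.NavierStokesRegularity.Theorems.PoloidalWindowDoorLrcModEntireCurvedTimeSplit

variable {G : ℝ × ℝ × ℝ → ℝ} {O : Set (ℝ × ℝ × ℝ)} {S I : Set ℝ} {d k : ℝ → ℝ} {κ R2 μ : ℝ → ℝ → ℝ}

/-- At `τ = 0` the `s`-derivative of the web function vanishes: `G(0,s,z) = d(z)` for `s` in the OPEN set `S`. -/
theorem fderiv_s_eq_zero_of_pin_on (hO : IsOpen O) (hG : ContDiffOn ℝ 2 G O) (hS : IsOpen S) (hpin : ∀ s ∈ S, ∀ z ∈ I, G (0, s, z) = d z)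
    {s z : ℝ} (hsS : s ∈ S) (hz : z ∈ I) (hq : ((0 : ℝ), s, z) ∈ O) :
    fderiv ℝ G ((0 : ℝ), s, z) ((0 : ℝ), (1 : ℝ), (0 : ℝ)) = 0 := by
  have hGd : DifferentiableAt ℝ G ((0 : ℝ), s, z) := (hG.contDiffAt (hO.mem_nhds hq)).differentiableAt (by norm_num)
  have h1 : HasDerivAt (fun a : ℝ => G ((0 : ℝ), a, z)) (fderiv ℝ G ((0 : ℝ), s, z) ((0 : ℝ), (1 : ℝ), (0 : ℝ))) s :=
    hGd.hasFDerivAt.comp_hasDerivAt s (hasDerivAt_sLine 0 z s)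
  have h2 : HasDerivAt (fun a : ℝ => G ((0 : ℝ), a, z)) 0 s := by
    have h : (fun a : ℝ => G ((0 : ℝ), a, z)) =ᶠ[𝓝 s] fun _ => d z := by
      filter_upwards [hS.mem_nhds hsS] with a ha using hpin a ha z hz
    exact (hasDerivAt_const s (d z)).congr_of_eventuallyEq h
  exact h1.unique h2

/-- At `τ = 0` the `z`-derivative of the web function is `d′(z)` (pin for `s ∈ S`). -/
theorem fderiv_z_eq_deriv_of_pin_on (hO : IsOpen O) (hG : ContDiffOn ℝ 2 G O) (hI : IsOpen I) (hpin : ∀ s ∈ S, ∀ z ∈ I, G (0, s, z) = d z)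
    (hd : ∀ z ∈ I, DifferentiableAt ℝ d z) {s z : ℝ} (hsS : s ∈ S) (hz : z ∈ I) (hq : ((0 : ℝ), s, z) ∈ O) :
    fderiv ℝ G ((0 : ℝ), s, z) ((0 : ℝ), (0 : ℝ), (1 : ℝ)) = deriv d z := by
  have hGd : DifferentiableAt ℝ G ((0 : ℝ), s, z) := (hG.contDiffAt (hO.mem_nhds hq)).differentiableAt (by norm_num)
  have h1 : HasDerivAt (fun a : ℝ => G ((0 : ℝ), s, a)) (fderiv ℝ G ((0 : ℝ), s, z) ((0 : ℝ), (0 : ℝ), (1 : ℝ))) z :=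
    hGd.hasFDerivAt.comp_hasDerivAt z (hasDerivAt_zLine 0 s z)
  have h2 : HasDerivAt (fun a : ℝ => G ((0 : ℝ), s, a)) (deriv d z) z := by
    have h : (fun a : ℝ => G ((0 : ℝ), s, a)) =ᶠ[𝓝 z] d := by
      filter_upwards [hI.mem_nhds hz] with a ha using hpin s hsS a ha
    exact (hd z hz).hasDerivAt.congr_of_eventuallyEq h
  exact h1.unique h2

/-- **The value of `∂_τ∂_zG(0,s,z)` over a curved branch** from the family of Fermi-frame Huygens identities
`κ(τ,z)·(1 − k(s)G)²·G_z² = (R″(τ,z) − μ(τ,z)κ(τ,z))·((1 − k(s)G)² + G_s²)` on `O`, the parallel webs `G(0,s,·) = d` on `I`, the Fermi factor `1 − k(s)d(z) ≠ 0`: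
`2κ(0,z)d′(z)·D(∂_zG)(0,s,z)[(1,0,0)] = ∂_τ(R″ − μκ)(0,z) − ∂_τκ(0,z)·d′(z)²` — the curvature drops out. -/
theorem curved_webSpeed_zderiv_eq_on (hO : IsOpen O) (hG : ContDiffOn ℝ 2 G O) (hS : IsOpen S) (hI : IsOpen I) (hpin : ∀ s ∈ S, ∀ z ∈ I, G (0, s, z) = d z)
    (hd : ∀ z ∈ I, DifferentiableAt ℝ d z)
    (hH : ∀ q ∈ O, κ q.1 q.2.2 * (1 - k q.2.1 * G q) ^ 2 * (fderiv ℝ G q ((0 : ℝ), (0 : ℝ), (1 : ℝ))) ^ 2 =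
      (R2 q.1 q.2.2 - μ q.1 q.2.2 * κ q.1 q.2.2) * ((1 - k q.2.1 * G q) ^ 2 + (fderiv ℝ G q ((0 : ℝ), (1 : ℝ), (0 : ℝ))) ^ 2))
    {s z : ℝ} (hsS : s ∈ S) (hz : z ∈ I) (hq : ((0 : ℝ), s, z) ∈ O) (hJ : 1 - k s * d z ≠ 0)
    {κ' c' : ℝ} (hκ : HasDerivAt (fun τ => κ τ z) κ' 0) (hc : HasDerivAt (fun τ => R2 τ z - μ τ z * κ τ z) c' 0) :
    2 * κ 0 z * deriv d z * fderiv ℝ (fun q => fderiv ℝ G q ((0 : ℝ), (0 : ℝ), (1 : ℝ))) ((0 : ℝ), s, z) ((1 : ℝ), (0 : ℝ), (0 : ℝ)) =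
      c' - κ' * deriv d z ^ 2 := by
  -- regularity at the base point
  have hGq : ContDiffAt ℝ 2 G ((0 : ℝ), s, z) := hG.contDiffAt (hO.mem_nhds hq)
  have hGd : DifferentiableAt ℝ G ((0 : ℝ), s, z) := hGq.differentiableAt (by norm_num)
  have hDGd : DifferentiableAt ℝ (fderiv ℝ G) ((0 : ℝ), s, z) := (hGq.fderiv_right (m := 1) le_rfl).differentiableAt (by simp)
  set ez : ℝ × ℝ × ℝ := ((0 : ℝ), (0 : ℝ), (1 : ℝ)) with hez
  set es : ℝ × ℝ × ℝ := ((0 : ℝ), (1 : ℝ), (0 : ℝ)) with hes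
  set eτ : ℝ × ℝ × ℝ := ((1 : ℝ), (0 : ℝ), (0 : ℝ)) with heτ
  -- the partial derivatives and the web function along the `τ`-line through `(0,s,z)`
  set φ : ℝ → ℝ := fun a => fderiv ℝ G (a, s, z) ez with hφ
  set ψ : ℝ → ℝ := fun a => fderiv ℝ G (a, s, z) es with hψ
  set g : ℝ → ℝ := fun a => G (a, s, z) with hg
  have hφd : HasDerivAt φ (fderiv ℝ (fun q => fderiv ℝ G q ez) ((0 : ℝ), s, z) eτ) 0 := by
    have h1 : DifferentiableAt ℝ (fun q => fderiv ℝ G q ez) ((0 : ℝ), s, z) := hDGd.clm_apply (differentiableAt_const _)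
    exact h1.hasFDerivAt.comp_hasDerivAt (0 : ℝ) (hasDerivAt_tauLine s z 0)
  have hψd : HasDerivAt ψ (fderiv ℝ (fun q => fderiv ℝ G q es) ((0 : ℝ), s, z) eτ) 0 := by
    have h1 : DifferentiableAt ℝ (fun q => fderiv ℝ G q es) ((0 : ℝ), s, z) := hDGd.clm_apply (differentiableAt_const _)
    exact h1.hasFDerivAt.comp_hasDerivAt (0 : ℝ) (hasDerivAt_tauLine s z 0)
  have hgd : HasDerivAt g (fderiv ℝ G ((0 : ℝ), s, z) eτ) 0 :=
    hGd.hasFDerivAt.comp_hasDerivAt (0 : ℝ) (hasDerivAt_tauLine s z 0)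
  -- values at `τ = 0`
  have hφ0 : φ 0 = deriv d z := fderiv_z_eq_deriv_of_pin_on hO hG hI hpin hd hsS hz hq
  have hψ0 : ψ 0 = 0 := fderiv_s_eq_zero_of_pin_on hO hG hS hpin hsS hz hq
  have hg0 : g 0 = d z := hpin s hsS z hz
  -- the identity along the `τ`-line, near `τ = 0`, and AT `τ = 0`
  have hnear : ∀ᶠ a : ℝ in 𝓝 0, ((a, s, z) : ℝ × ℝ × ℝ) ∈ O :=
    (hasDerivAt_tauLine s z 0).continuousAt.preimage_mem_nhds (by simpa using hO.mem_nhds hq)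
  have hid : (fun a : ℝ => κ a z * (1 - k s * g a) ^ 2 * φ a ^ 2) =ᶠ[𝓝 0]
      fun a => (R2 a z - μ a z * κ a z) * ((1 - k s * g a) ^ 2 + ψ a ^ 2) := by
    filter_upwards [hnear] with a ha using hH (a, s, z) ha
  have hid0 : κ 0 z * (1 - k s * d z) ^ 2 * deriv d z ^ 2 = (R2 0 z - μ 0 z * κ 0 z) * (1 - k s * d z) ^ 2 := by
    have h := hH ((0 : ℝ), s, z) hq
    simp only at h
    rw [show fderiv ℝ G ((0 : ℝ), s, z) ez = φ 0 from rfl, show fderiv ℝ G ((0 : ℝ), s, z) es = ψ 0 from rfl, hφ0, hψ0,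
      show G ((0 : ℝ), s, z) = g 0 from rfl, hg0] at h
    linear_combination h
  -- the coefficient at `τ = 0`: `R″ − μκ = κ d′²` (Fermi factor ≠ 0)
  have hc0 : R2 0 z - μ 0 z * κ 0 z = κ 0 z * deriv d z ^ 2 := by
    have hJ2 : (1 - k s * d z) ^ 2 ≠ 0 := pow_ne_zero 2 hJ
    have h : (R2 0 z - μ 0 z * κ 0 z - κ 0 z * deriv d z ^ 2) * (1 - k s * d z) ^ 2 = 0 := by linear_combination -hid0
    rcases mul_eq_zero.1 h with h1 | h1
    · linarith
    · exact absurd h1 hJ2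
  -- differentiate both sides at `τ = 0`
  have hJd : HasDerivAt (fun a => (1 - k s * g a) ^ 2) (2 * (1 - k s * d z) * (-(k s * fderiv ℝ G ((0 : ℝ), s, z) eτ))) 0 := by
    have h1 : HasDerivAt (fun a => 1 - k s * g a) (0 - k s * fderiv ℝ G ((0 : ℝ), s, z) eτ) 0 :=
      (hasDerivAt_const (0 : ℝ) (1 : ℝ)).fun_sub (hgd.const_mul (k s))
    have h := h1.fun_pow 2
    refine h.congr_deriv ?_
    rw [hg0]
    push_cast
    ring
  have hL := (hκ.mul hJd).mul (hφd.pow 2)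
  have hR := hc.mul (hJd.add (hψd.pow 2))
  have hid' : (((fun τ => κ τ z) * fun a => (1 - k s * g a) ^ 2) * φ ^ 2) =ᶠ[𝓝 0]
      ((fun τ => R2 τ z - μ τ z * κ τ z) * ((fun a => (1 - k s * g a) ^ 2) + ψ ^ 2)) := by
    filter_upwards [hid] with a ha
    simp only [Pi.mul_apply, Pi.add_apply, Pi.pow_apply]
    exact ha
  have heq := hL.unique (hR.congr_of_eventuallyEq hid')
  simp only [Pi.mul_apply, Pi.add_apply, Pi.pow_apply] at heq
  rw [hφ0, hψ0, hg0, hc0] at heq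
  push_cast at heq
  -- `heq` is `J²·(κ′d′² + 2κd′φ′) + (common) = J²·c′ + (common)`; cancel `J² ≠ 0`
  have hJ2 : (1 - k s * d z) ^ 2 ≠ 0 := pow_ne_zero 2 hJ
  have hkey : (1 - k s * d z) ^ 2 *
      (2 * κ 0 z * deriv d z * fderiv ℝ (fun q => fderiv ℝ G q ez) ((0 : ℝ), s, z) eτ - (c' - κ' * deriv d z ^ 2)) = 0 := by
    linear_combination heq
  rcases mul_eq_zero.1 hkey with h1 | h1
  · exact absurd h1 hJ2
  · linarith


/-- ★ **HUYGENS IN TIME OVER A CURVED BRANCH — the height-derivative of the web speed does not depend on `s`:** under the hypotheses of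
`curved_webSpeed_zderiv_eq` at two points `(0,s,z), (0,s′,z) ∈ O` with Fermi factors `1 − k(s)d(z), 1 − k(s′)d(z) ≠ 0`, `κ(0,z) ≠ 0`, `d′(z) ≠ 0` and the
coefficients differentiable in `τ` at `(0,z)`: `D(∂_zG)(0,s,z)[(1,0,0)] = D(∂_zG)(0,s′,z)[(1,0,0)]`. -/
theorem curved_webSpeed_zderiv_indep_on (hO : IsOpen O) (hG : ContDiffOn ℝ 2 G O) (hS : IsOpen S) (hI : IsOpen I) (hpin : ∀ s ∈ S, ∀ z ∈ I, G (0, s, z) = d z)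
    (hd : ∀ z ∈ I, DifferentiableAt ℝ d z)
    (hH : ∀ q ∈ O, κ q.1 q.2.2 * (1 - k q.2.1 * G q) ^ 2 * (fderiv ℝ G q ((0 : ℝ), (0 : ℝ), (1 : ℝ))) ^ 2 =
      (R2 q.1 q.2.2 - μ q.1 q.2.2 * κ q.1 q.2.2) * ((1 - k q.2.1 * G q) ^ 2 + (fderiv ℝ G q ((0 : ℝ), (1 : ℝ), (0 : ℝ))) ^ 2))
    {z : ℝ} (hz : z ∈ I) (hκ0 : κ 0 z ≠ 0) (hd0 : deriv d z ≠ 0)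
    (hκ : DifferentiableAt ℝ (fun τ => κ τ z) 0) (hR2 : DifferentiableAt ℝ (fun τ => R2 τ z) 0) (hμ : DifferentiableAt ℝ (fun τ => μ τ z) 0)
    {s s' : ℝ} (hsS : s ∈ S) (hsS' : s' ∈ S) (hq : ((0 : ℝ), s, z) ∈ O) (hq' : ((0 : ℝ), s', z) ∈ O) (hJ : 1 - k s * d z ≠ 0) (hJ' : 1 - k s' * d z ≠ 0) :
    fderiv ℝ (fun q => fderiv ℝ G q ((0 : ℝ), (0 : ℝ), (1 : ℝ))) ((0 : ℝ), s, z) ((1 : ℝ), (0 : ℝ), (0 : ℝ)) =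
      fderiv ℝ (fun q => fderiv ℝ G q ((0 : ℝ), (0 : ℝ), (1 : ℝ))) ((0 : ℝ), s', z) ((1 : ℝ), (0 : ℝ), (0 : ℝ)) := by
  have hc : HasDerivAt (fun τ => R2 τ z - μ τ z * κ τ z) (deriv (fun τ => R2 τ z - μ τ z * κ τ z) 0) 0 :=
    (hR2.sub (hμ.mul hκ)).hasDerivAt
  have h1 := curved_webSpeed_zderiv_eq_on hO hG hS hI hpin hd hH hsS hz hq hJ hκ.hasDerivAt hc
  have h2 := curved_webSpeed_zderiv_eq_on hO hG hS hI hpin hd hH hsS' hz hq' hJ' hκ.hasDerivAt hc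
  have hne : 2 * κ 0 z * deriv d z ≠ 0 := mul_ne_zero (mul_ne_zero two_ne_zero hκ0) hd0
  exact mul_left_cancel₀ hne (h1.trans h2.symm)

/-- ★ **THE SPLIT `V(s,z) = α(s) + β(z)` of the web speed over a curved branch** (`V(s,z) := ∂_τG(0,s,z)`) on a height interval `I = (z₁,z₂)` where `κ(0,·) ≠ 0`,
`d′ ≠ 0` and the Fermi factors of the two base parameters `s, s′` do not vanish: `V(s,z) − V(s′,z)` does not depend on `z ∈ I`. -/
theorem curved_webSpeed_split_on (hO : IsOpen O) (hG : ContDiffOn ℝ 2 G O) (hS : IsOpen S) {z₁ z₂ : ℝ} (hI : I = Ioo z₁ z₂) (hpin : ∀ s ∈ S, ∀ z ∈ I, G (0, s, z) = d z)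
    (hd : ∀ z ∈ I, DifferentiableAt ℝ d z)
    (hH : ∀ q ∈ O, κ q.1 q.2.2 * (1 - k q.2.1 * G q) ^ 2 * (fderiv ℝ G q ((0 : ℝ), (0 : ℝ), (1 : ℝ))) ^ 2 =
      (R2 q.1 q.2.2 - μ q.1 q.2.2 * κ q.1 q.2.2) * ((1 - k q.2.1 * G q) ^ 2 + (fderiv ℝ G q ((0 : ℝ), (1 : ℝ), (0 : ℝ))) ^ 2))
    (hκ0 : ∀ z ∈ I, κ 0 z ≠ 0) (hd0 : ∀ z ∈ I, deriv d z ≠ 0)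
    (hκ : ∀ z ∈ I, DifferentiableAt ℝ (fun τ => κ τ z) 0) (hR2 : ∀ z ∈ I, DifferentiableAt ℝ (fun τ => R2 τ z) 0)
    (hμ : ∀ z ∈ I, DifferentiableAt ℝ (fun τ => μ τ z) 0)
    {s s' : ℝ} (hsS : s ∈ S) (hsS' : s' ∈ S) (hs : ∀ z ∈ I, ((0 : ℝ), s, z) ∈ O) (hs' : ∀ z ∈ I, ((0 : ℝ), s', z) ∈ O)
    (hJ : ∀ z ∈ I, 1 - k s * d z ≠ 0) (hJ' : ∀ z ∈ I, 1 - k s' * d z ≠ 0) {z z₀ : ℝ} (hz : z ∈ I) (hz₀ : z₀ ∈ I) :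
    fderiv ℝ G ((0 : ℝ), s, z) ((1 : ℝ), (0 : ℝ), (0 : ℝ)) - fderiv ℝ G ((0 : ℝ), s', z) ((1 : ℝ), (0 : ℝ), (0 : ℝ)) =
      fderiv ℝ G ((0 : ℝ), s, z₀) ((1 : ℝ), (0 : ℝ), (0 : ℝ)) - fderiv ℝ G ((0 : ℝ), s', z₀) ((1 : ℝ), (0 : ℝ), (0 : ℝ)) := by
  subst hI
  set eτ : ℝ × ℝ × ℝ := ((1 : ℝ), (0 : ℝ), (0 : ℝ)) with heτ
  set ez : ℝ × ℝ × ℝ := ((0 : ℝ), (0 : ℝ), (1 : ℝ)) with hez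
  -- the difference `D(w) = V(s,w) − V(s′,w)` has zero derivative on the interval
  set D : ℝ → ℝ := fun w => fderiv ℝ G ((0 : ℝ), s, w) eτ - fderiv ℝ G ((0 : ℝ), s', w) eτ with hD
  have hderiv : ∀ w ∈ Ioo z₁ z₂, HasDerivAt D 0 w := by
    intro w hw
    have hq : ContDiffAt ℝ 2 G ((0 : ℝ), s, w) := hG.contDiffAt (hO.mem_nhds (hs w hw))
    have hq' : ContDiffAt ℝ 2 G ((0 : ℝ), s', w) := hG.contDiffAt (hO.mem_nhds (hs' w hw))
    have hD1 : DifferentiableAt ℝ (fderiv ℝ G) ((0 : ℝ), s, w) := (hq.fderiv_right (m := 1) le_rfl).differentiableAt (by simp)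
    have hD1' : DifferentiableAt ℝ (fderiv ℝ G) ((0 : ℝ), s', w) := (hq'.fderiv_right (m := 1) le_rfl).differentiableAt (by simp)
    have h1 : HasDerivAt (fun w : ℝ => fderiv ℝ G ((0 : ℝ), s, w) eτ) (fderiv ℝ (fun q => fderiv ℝ G q eτ) ((0 : ℝ), s, w) ez) w := by
      have h := (hD1.clm_apply (differentiableAt_const eτ)).hasFDerivAt.comp_hasDerivAt w (hasDerivAt_zLine 0 s w)
      simpa only [Function.comp_def] using h
    have h1' : HasDerivAt (fun w : ℝ => fderiv ℝ G ((0 : ℝ), s', w) eτ) (fderiv ℝ (fun q => fderiv ℝ G q eτ) ((0 : ℝ), s', w) ez) w := by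
      have h := (hD1'.clm_apply (differentiableAt_const eτ)).hasFDerivAt.comp_hasDerivAt w (hasDerivAt_zLine 0 s' w)
      simpa only [Function.comp_def] using h
    have hsw := curved_webSpeed_zderiv_indep_on hO hG hS isOpen_Ioo hpin hd hH hw (hκ0 w hw) (hd0 w hw) (hκ w hw) (hR2 w hw) (hμ w hw)
      hsS hsS' (hs w hw) (hs' w hw) (hJ w hw) (hJ' w hw)
    rw [fderiv_dz_dtau_swap hq, fderiv_dz_dtau_swap hq'] at hsw
    have h := h1.sub h1'
    rw [hsw, sub_self] at h
    exact h
  exact isOpen_Ioo.is_const_of_deriv_eq_zero isPreconnected_Ioo (fun w hw => (hderiv w hw).differentiableAt.differentiableWithinAt)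
    (fun w hw => (hderiv w hw).deriv) hz hz₀

end Summit.NavierStokesRegularity.NavierStokesRegularity.Theorems.PoloidalWindowDoorLrcModEntireCurvedTimeSplitLocal

end
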